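import Literature.Computability.AlgebraicComplexity.MoreAsymmetricCellData
import Literature.Computability.AlgebraicComplexity.GlobalStageEpsilon
import HarnessLib

/-!
# ADVXXZ Theorem 5.3, one region: `2^{o(n)}` copies of `(CW_q^{⊗c})^{⊗n}` degenerate to
`2^{(E₁ − o_ε(1)) n − o(n)}` copies of the level-`ℓ` `ε`-interface tensor,
`E₁ = min{H(α_X) − P_α, H(β̄_Y) − η_Y, H(β̄_Z) − λ_Z}` — proved, explicit errors
(Alman–Duan–Vassilevska Williams–Xu–Xu–Zhou 2025, Thm. 5.3, first region)

Topic `Literature/Computability/AlgebraicComplexity`.  Theorem 5.3 of Alman–Duan–Vassilevska Williams–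
Xu–Xu–Zhou, *More asymmetry yields faster matrix multiplication* (SODA 2025, arXiv:2404.16349) — "a
corollary of Prop. 5.1.  We omit its proof as it is similar to the proof of [VXXZ24]" — for the first
region (identity permutation of the dimensions).  The proof is VXXZ's (formalised in
`GlobalStageEpsilon.lean` for their exponent), with the more asymmetric one-region Prop. 5.1
(`advxxz2025_thm53_cell`, `MoreAsymmetricCellData.lean`) in place of theirs and ONE more continuity step,
for the `Y`-dimension:

1. one copy of the input per realised cell of `𝒯_{τ₀,L(β),ε}` (at most `((n+1)^{3^c|S₃|})^3 = 2^{o(n)}`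
   cells) is degenerated by Prop. 5.1 into `κ_ξ` copies of the exact interface tensor of the cell,
   `log₂(κ_ξ+1) ≥ n E₁'(ξ) − thm53Err`;
2. (continuity) **`E₁'(ξ) ≥ E₁ − epsLoss₂(ε)`**: the realised joint types `θ_Y/n` of `(J₀, ŷ)` and `θ_Z/n`
   of `(K₀, ẑ)` are within `ε` of `θ̄_Y = β̄_Y` (`targetPairDistY`) and `θ̄_Z = β̄_Z` (`targetPairDist`),
   and `ŷ`, `ẑ` are `ε`-admissible for the coarse data (averaging over `S_{*,j,+}`, resp. `S_{+,+,k}`, keeps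
   `ε`-consistency: `splitConsistentOn_posClassYpos`, `splitConsistentOn_posClassPP`), so by the entropy
   modulus `H(θ_Y/n) ≥ H(β̄_Y) − |A_pair| m(ε)`, `Λ_Y/n ≤ η_Y + 3^c m(ε)` (`realisedEta_le_targetEta_add`)
   and likewise for `Z`;
3. (merge) with the uniform `κ = ⌈2^{bound}⌉ − 1 ≤ κ_ξ`:
   `⟨#cells⟩ ⊗ input ≥ ⊕_ξ input ≥ ⊕_ξ ⟨κ⟩ ⊗ 𝒯_ξ ≥ ⟨κ⟩ ⊗ ⊕_ξ 𝒯_ξ ≥ ⟨κ⟩ ⊗ 𝒯_{τ₀,L(β),ε}` (`vxxz2024_thm53_merge`).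

Main statement: `advxxz2025_thm53_region`.  Definitions: `targetPairDistY` (`β̄_Y` as a distribution on
pairs (level, shape)), `targetEta` (`η_Y`), `epsLoss₂` (the explicit `o_{1/ε}(1)`, twice VXXZ's, `→ 0`
as `ε → 0`).  Everything is proved; no named facts.

## References

* J. Alman, R. Duan, V. Vassilevska Williams, Y. Xu, Z. Xu, R. Zhou, *More asymmetry yields faster
  matrix multiplication*, SODA 2025, arXiv:2404.16349 (held: `paper:arxiv-2404.16349`, chunk p0015):
  Thm. 5.3, Prop. 5.1 (`E_r`, `η_Y`, `λ_Z`). [AlmanDuanVassilevskaWilliamsXuXuZhou2025]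
* V. Vassilevska Williams, Y. Xu, Z. Xu, R. Zhou, *New bounds for matrix multiplication: from alpha
  to omega*, SODA 2024, arXiv:2307.07970, Thm. 5.3 and its proof (p. 19). [VassilevskaWilliamsXuXuZhou2024]
-/

noncomputable section

open scoped BigOperators
open Finset Filter

namespace Literature.Computability.AlgebraicComplexity

open Literature.Barriers.MatrixMultiplication (bigCwTensor)

universe u

/-! ## `ε`-admissibility passes to the coarse `Y`-datum (Claim 5.18 up to `ε`) -/

section CoarseEpsY

variable {c n : ℕ}

/-- An `ε`-admissible `Y`-sequence of `𝒯_{τ₀,L(β),ε}` is `ε`-consistent with `β_{Y,i,j,k}` on every occurring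
class `S_{i,j,k}`. [cite: AlmanDuanVassilevskaWilliamsXuXuZhou2025, Def. 4.1 (ε-interface tensor)] -/
theorem splitConsistentOn_posClass_of_mem_levelBlocksY {I J K : Fin n → ℕ} (h : IsLevelTriple c I J K)
    {γX γY γZ : ℕ × ℕ × ℕ → (Fin c → Fin 3) → ℝ} {ε : ℝ} {Jh : Fin n → Fin c → Fin 3}
    (hJ : Jh ∈ levelBlocksY (tripleTermMap h) (tripleTermList c γX γY γZ) ε) (i j k : ℕ)
    (hne : (posClass I J K i j k).Nonempty) : SplitConsistentOn ε (γY (i, j, k)) Jh (posClass I J K i j k) := by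
  by_cases hijk : i + j + k = 2 * c
  · set s := (constituentTriples c).equivFin ⟨(i, j, k), (mem_constituentTriples c).2 hijk⟩ with hs_def
    have hs : (univ.filter fun t => tripleTermMap h t = s) = posClass I J K i j k := by
      rw [filter_tripleTermMap_eq h s]; simp [s]
    have := (mem_admissibleSeqs.1 hJ).2 s (by rw [hs]; exact hne)
    rw [hs] at this
    simpa [tripleTermList, s] using this
  · exfalso
    rw [posClass_eq_empty h hijk] at hne
    exact Finset.not_nonempty_empty hne

/-- **Averaging preserves `ε`-consistency on `S_{*,j,+}`**: if `Ĵ` is `ε`-consistent with `β_{Y,i,j,k}` on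
every occurring class `S_{i,j,k}` with `k > 0` of an `α`-consistent triple, then on `S_{*,j,+}` it is
`ε`-consistent with `β̄_{Y,*,j,+}`. [cite: AlmanDuanVassilevskaWilliamsXuXuZhou2025, Claim 5.18 and Thm. 5.3 (proof, continuity)] -/
theorem splitConsistentOn_posClassYpos {α : ℕ × ℕ × ℕ → ℝ} {γY : ℕ × ℕ × ℕ → (Fin c → Fin 3) → ℝ}
    {I J K : Fin n → ℕ} (h : IsLevelTriple c I J K) (hα : IsAlphaConsistent α I J K) {Jh : Fin n → Fin c → Fin 3}
    {ε : ℝ} (j : ℕ)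
    (hfine : ∀ i, (posClass I J K i j (2 * c - j - i)).Nonempty →
      SplitConsistentOn ε (γY (i, j, 2 * c - j - i)) Jh (posClass I J K i j (2 * c - j - i)))
    (hne : (posClassYpos J K j).Nonempty) : SplitConsistentOn ε (gammaBarYpos c α γY j) Jh (posClassYpos J K j) := by
  intro σ
  set PP := posClassYpos J K j with hPP
  have hPPpos : (0 : ℝ) < PP.card := by exact_mod_cast hne.card_pos
  -- sizes
  have hcard : (PP.card : ℝ) = ∑ i ∈ range (2 * c - j), ((posClass I J K i j (2 * c - j - i)).card : ℝ) := by
    rw [hPP, card_posClassYpos_eq_sum h j]; push_cast; rfl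
  have hcardPP : (PP.card : ℝ) = alphaYpos c α j * n := by
    rw [hPP, alphaYpos]; exact card_posClassYpos_eq_alpha_mul h hα j
  have hαPP : alphaYpos c α j ≠ 0 := by
    intro h0; rw [h0, zero_mul] at hcardPP; exact hPPpos.ne' hcardPP
  -- numerator of the split distribution on `S_{*,j,+}`
  have hnum : completeSplitOn Jh PP σ * PP.card =
      ∑ i ∈ range (2 * c - j), completeSplitOn Jh (posClass I J K i j (2 * c - j - i)) σ * (posClass I J K i j (2 * c - j - i)).card := by
    rw [hPP]; exact completeSplitOn_posClassYpos_mul_card h Jh j σ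
  -- the average `β̄` times `|S_{*,j,+}|`
  have hbar : gammaBarYpos c α γY j σ * PP.card =
      ∑ i ∈ range (2 * c - j), (posClass I J K i j (2 * c - j - i)).card * γY (i, j, 2 * c - j - i) σ := by
    have e1 : gammaBarYpos c α γY j σ * alphaYpos c α j =
        ∑ i ∈ range (2 * c - j), α (i, j, 2 * c - j - i) * γY (i, j, 2 * c - j - i) σ := by
      have hden : (∑ i ∈ range (2 * c - j), α (i, j, 2 * c - j - i)) ≠ 0 := hαPP
      simp only [gammaBarYpos]
      rw [show alphaYpos c α j = ∑ i ∈ range (2 * c - j), α (i, j, 2 * c - j - i) from rfl, div_mul_cancel₀ _ hden]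
    rw [hcardPP, ← mul_assoc, e1, sum_mul]
    refine sum_congr rfl fun i _ => ?_
    rw [hα]; ring
  have hdiff : (completeSplitOn Jh PP σ - gammaBarYpos c α γY j σ) * PP.card =
      ∑ i ∈ range (2 * c - j), ((posClass I J K i j (2 * c - j - i)).card : ℝ) *
        (completeSplitOn Jh (posClass I J K i j (2 * c - j - i)) σ - γY (i, j, 2 * c - j - i) σ) := by
    rw [sub_mul, hnum, hbar, ← sum_sub_distrib]
    refine sum_congr rfl fun i _ => ?_; ring
  have habs : |completeSplitOn Jh PP σ - gammaBarYpos c α γY j σ| * PP.card ≤ ε * PP.card := by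
    rw [← abs_of_pos hPPpos, ← abs_mul, hdiff, abs_of_pos hPPpos, hcard, mul_sum]
    refine (abs_sum_le_sum_abs _ _).trans (sum_le_sum fun i _ => ?_)
    rcases (posClass I J K i j (2 * c - j - i)).eq_empty_or_nonempty with h0 | hne'
    · rw [h0, card_empty, Nat.cast_zero, zero_mul, abs_zero, mul_zero]
    · rw [abs_mul, abs_of_nonneg (Nat.cast_nonneg _), mul_comm]
      exact mul_le_mul_of_nonneg_right (hfine i hne' σ) (Nat.cast_nonneg _)
  exact le_of_mul_le_mul_right habs hPPpos

/-- **An `ε`-admissible `Y`-sequence of `𝒯_{τ₀,L(β),ε}` is `ε`-admissible for the coarse `Y`-datum**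
(`ε`-consistent with `β_{Y,i,j,0}` on the classes `S_{i,j,0}` and with `β̄_{Y,*,j,+}` on `S_{*,j,+}`).
[cite: AlmanDuanVassilevskaWilliamsXuXuZhou2025, Claim 5.18 and Thm. 5.3 (proof)] -/
theorem mem_levelBlocksX_coarseY_of_mem_levelBlocksY {α : ℕ × ℕ × ℕ → ℝ} {γX γY γZ : ℕ × ℕ × ℕ → (Fin c → Fin 3) → ℝ}
    {I J K : Fin n → ℕ} (h : IsLevelTriple c I J K) (hα : IsAlphaConsistent α I J K) {Jh : Fin n → Fin c → Fin 3}
    {ε : ℝ} (hJ : Jh ∈ levelBlocksY (tripleTermMap h) (tripleTermList c γX γY γZ) ε) :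
    Jh ∈ levelBlocksX (coarseYTermMap h) (coarseYTermList c α γY) ε := by
  have hlevJ : chunkLevels Jh = J := chunkLevels_eq_of_mem_levelBlocksY_triple h hJ
  rw [levelBlocksX, mem_admissibleSeqs]
  refine ⟨fun t => ?_, fun s hne => ?_⟩
  · simp only [coarseYTermList, coarseYTermMap, Equiv.symm_apply_apply]
    have : (coarseYClassOf I J K t).2 = J t := by
      unfold coarseYClassOf; split_ifs <;> rfl
    rw [this, ← hlevJ, chunkLevels_apply]
  · rw [filter_coarseYTermMap_eq] at hne ⊢
    simp only [coarseYTermList]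
    generalize hcs : (coarseYClasses c).equivFin.symm s = cs at hne ⊢
    obtain ⟨cl, hcl⟩ := cs
    rcases cl with ⟨_ | i, j⟩
    · rw [filter_coarseYClassOf_none] at hne ⊢
      simp only [coarseYGamma]
      exact splitConsistentOn_posClassYpos h hα j
        (fun i hne' => splitConsistentOn_posClass_of_mem_levelBlocksY h hJ _ _ _ hne') hne
    · rw [filter_coarseYClassOf_some] at hne ⊢
      simp only [coarseYGamma]
      exact splitConsistentOn_posClass_of_mem_levelBlocksY h hJ i j 0 hne

/-- The coarse `Y`-split distributions lie in `[0, 1]` when the `β_Y` do and `α ≥ 0`. [cite: AlmanDuanVassilevskaWilliamsXuXuZhou2025, Claim 5.17 (β̄_{Y,*,j,+})] -/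
theorem coarseYGamma_mem_Icc {α : ℕ × ℕ × ℕ → ℝ} {γY : ℕ × ℕ × ℕ → (Fin c → Fin 3) → ℝ}
    (hα0 : ∀ ijk, 0 ≤ α ijk) (hγ0 : ∀ ijk σ, 0 ≤ γY ijk σ) (hγ1 : ∀ ijk σ, γY ijk σ ≤ 1)
    (cl : Option ℕ × ℕ) (σ : Fin c → Fin 3) : 0 ≤ coarseYGamma c α γY cl σ ∧ coarseYGamma c α γY cl σ ≤ 1 := by
  rcases cl with ⟨_ | i, j⟩
  · simp only [coarseYGamma, gammaBarYpos]
    set F := range (2 * c - j)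
    have hden : 0 ≤ ∑ i ∈ F, α (i, j, 2 * c - j - i) := sum_nonneg fun i _ => hα0 _
    have hnum0 : 0 ≤ ∑ i ∈ F, α (i, j, 2 * c - j - i) * γY (i, j, 2 * c - j - i) σ :=
      sum_nonneg fun i _ => mul_nonneg (hα0 _) (hγ0 _ _)
    have hnum1 : ∑ i ∈ F, α (i, j, 2 * c - j - i) * γY (i, j, 2 * c - j - i) σ ≤ ∑ i ∈ F, α (i, j, 2 * c - j - i) :=
      sum_le_sum fun i _ => by nlinarith [hα0 (i, j, 2 * c - j - i), hγ1 (i, j, 2 * c - j - i) σ]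
    refine ⟨div_nonneg hnum0 hden, ?_⟩
    rcases hden.eq_or_lt with h0 | hpos
    · rw [← h0, div_zero]; exact zero_le_one
    · rw [div_le_one hpos]; exact hnum1
  · simp only [coarseYGamma]
    exact ⟨hγ0 _ _, hγ1 _ _⟩

end CoarseEpsY

/-! ## The `Y`-target exponent of region 1 at the type `Q/n`: `H(β̄_Y)` and `η_Y` -/

section TargetY

variable {c n : ℕ}

/-- **`β̄_Y` as a distribution on pairs (level, chunk shape)**: `θ̄_Y(j', σ) = ∑_{t : j_t = j'} (n_t/n) β_Y^{(t)}(σ)`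
over the terms `t = (i_t, j_t, k_t)` of `𝒯*_{T₀}`.  Its entropy is `H(β̄_Y)` for split distributions supported on
shapes of the right level. [cite: AlmanDuanVassilevskaWilliamsXuXuZhou2025, §5 (notation β̄) and Claim 5.17 (H(β̄_{Y,*,*,*}))] -/
def targetPairDistY {I J K : Fin n → ℕ} (h : IsLevelTriple c I J K) (γY : ℕ × ℕ × ℕ → (Fin c → Fin 3) → ℝ) :
    Fin (2 * c + 1) × (Fin c → Fin 3) → ℝ := fun p =>
  ∑ s : Fin (constituentTriples c).card,
    if ((constituentTriples c).equivFin.symm s).1.2.1 = (p.1 : ℕ) then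
      ((termFibre (tripleTermMap h) s).card : ℝ) / n * γY ((constituentTriples c).equivFin.symm s).1 p.2
    else 0

/-- **`η_Y` at the type**: `∑_S (|S|/n) H(β_S)` over the coarse `Y`-classes `S` of Claim 5.18 (`β_S = β_{Y,i,j,0}`
on `S_{i,j,0}`, `β̄_{Y,*,j,+}` on `S_{*,j,+}`; `|S|/n = α(i,j,0)`, resp. `α(*,j,+)`), i.e. the printed
`η_Y = ∑_{k=0} α(i,j,k) H(β_{Y,i,j,k}) + ∑_j α(*,j,+) H(β̄_{Y,*,j,+})`. [cite: AlmanDuanVassilevskaWilliamsXuXuZhou2025, Claim 5.17 (η_Y)] -/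
def targetEta {I J K : Fin n → ℕ} (h : IsLevelTriple c I J K) (α : ℕ × ℕ × ℕ → ℝ)
    (γY : ℕ × ℕ × ℕ → (Fin c → Fin 3) → ℝ) : ℝ :=
  ∑ s : Fin (coarseYClasses c).card,
    ((termFibre (coarseYTermMap h) s).card : ℝ) / n * shannonEntropy (coarseYTermList c α γY s).γX

/-- **The `o_{1/ε}(1)` of Thm. 5.3 (one region, more asymmetric), explicit**: `2 (|A_pair| + 3^c) · m(ε)`
(the `Y`- and the `Z`-continuity losses). [cite: AlmanDuanVassilevskaWilliamsXuXuZhou2025, Thm. 5.3 ("− o_{1/ε}(1)")] -/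
def epsLoss₂ (c : ℕ) (ε : ℝ) : ℝ := 2 * epsLoss c ε

/-- `epsLoss₂ ≥ 0` on `[0, 1]`. [folklore] -/
theorem epsLoss₂_nonneg (c : ℕ) {ε : ℝ} (h0 : 0 ≤ ε) (h1 : ε ≤ 1) : 0 ≤ epsLoss₂ c ε :=
  mul_nonneg zero_le_two (epsLoss_nonneg c h0 h1)

/-- **`epsLoss₂ → 0` as `ε → 0`.** [cite: AlmanDuanVassilevskaWilliamsXuXuZhou2025, Thm. 5.3 (footnote: o_{1/ε}(1) → 0 as ε → 0)] -/
theorem tendsto_epsLoss₂ (c : ℕ) : Tendsto (epsLoss₂ c) (nhds 0) (nhds 0) := by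
  have := (tendsto_epsLoss c).const_mul 2
  rw [mul_zero] at this
  exact this

/-- `0 ≤ θ̄_Y ≤ 1` pointwise when `0 ≤ β_Y ≤ 1`. [folklore] -/
theorem targetPairDistY_mem_Icc {I J K : Fin n → ℕ} (h : IsLevelTriple c I J K) {γY : ℕ × ℕ × ℕ → (Fin c → Fin 3) → ℝ}
    (hγ0 : ∀ ijk σ, 0 ≤ γY ijk σ) (hγ1 : ∀ ijk σ, γY ijk σ ≤ 1) (p : Fin (2 * c + 1) × (Fin c → Fin 3)) :
    0 ≤ targetPairDistY h γY p ∧ targetPairDistY h γY p ≤ 1 := by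
  unfold targetPairDistY
  refine ⟨sum_nonneg fun s _ => ?_, ?_⟩
  · split_ifs
    · exact mul_nonneg (by positivity) (hγ0 _ _)
    · exact le_rfl
  · refine (sum_le_sum (g := fun s => ((termFibre (tripleTermMap h) s).card : ℝ) / n) fun s _ => ?_).trans
      (sum_card_termFibre_div_le _)
    split_ifs
    · have := hγ1 ((constituentTriples c).equivFin.symm s).1 p.2
      have h0 : (0 : ℝ) ≤ ((termFibre (tripleTermMap h) s).card : ℝ) / n := by positivity
      nlinarith
    · positivity

/-- **The joint type of `(J₀, Ĵ)` over `n`, term by term**: `θ_Y(j', σ)/n = ∑_{t : j_t = j'} (n_t/n) split(Ĵ, term t)(σ)`.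
[cite: AlmanDuanVassilevskaWilliamsXuXuZhou2025, Claim 5.17 (proof, quantity P)] -/
theorem letterCount_pairSeqY_div_eq_sum (T : (Fin n → Fin (2 * c + 1)) × (Fin n → Fin (2 * c + 1)) × (Fin n → Fin (2 * c + 1)))
    (h : IsLevelTriple c (seqVal T.1) (seqVal T.2.1) (seqVal T.2.2)) (Jh : Fin n → Fin c → Fin 3)
    (p : Fin (2 * c + 1) × (Fin c → Fin 3)) :
    ((letterCount (GlobalStageData.pairSeq T.2.1 Jh) p : ℕ) : ℝ) / n =
      ∑ s : Fin (constituentTriples c).card,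
        if ((constituentTriples c).equivFin.symm s).1.2.1 = (p.1 : ℕ) then
          ((termFibre (tripleTermMap h) s).card : ℝ) / n * completeSplitOn Jh (termFibre (tripleTermMap h) s) p.2
        else 0 := by
  classical
  have hterm : ∀ s : Fin (constituentTriples c).card,
      ((termFibre (tripleTermMap h) s).card : ℝ) / n * completeSplitOn Jh (termFibre (tripleTermMap h) s) p.2 =
        (((termFibre (tripleTermMap h) s).filter fun t => Jh t = p.2).card : ℝ) / n := by
    intro s
    rw [div_mul_eq_mul_div, mul_comm, completeSplitOn_mul_card]
  simp_rw [hterm]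
  rw [letterCount_apply, card_eq_sum_card_fiberwise (f := tripleTermMap h)
    (s := univ.filter fun m => GlobalStageData.pairSeq T.2.1 Jh m = p) (t := univ) (fun _ _ => mem_univ _)]
  push_cast
  rw [sum_div]
  refine sum_congr rfl fun s _ => ?_
  have hfib : ∀ t, tripleTermMap h t = s → (T.2.1 t : ℕ) = ((constituentTriples c).equivFin.symm s).1.2.1 := by
    intro t ht
    have ht' : t ∈ univ.filter fun t => tripleTermMap h t = s := by simp [ht]
    rw [filter_tripleTermMap_eq h s, mem_posClass] at ht'
    exact ht'.2.1
  split_ifs with hk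
  · have hXY : ((univ.filter fun m => GlobalStageData.pairSeq T.2.1 Jh m = p).filter fun t => tripleTermMap h t = s) =
        (termFibre (tripleTermMap h) s).filter fun t => Jh t = p.2 := by
      ext t
      simp only [mem_filter, mem_univ, true_and, GlobalStageData.pairSeq, Prod.ext_iff, termFibre]
      constructor
      · rintro ⟨⟨-, h2⟩, h3⟩; exact ⟨h3, h2⟩
      · rintro ⟨h3, h2⟩
        refine ⟨⟨Fin.ext ?_, h2⟩, h3⟩
        rw [hfib t h3, hk]
    rw [hXY]
  · rw [div_eq_zero_iff]
    left
    norm_cast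
    rw [card_eq_zero, filter_eq_empty_iff]
    intro t ht hts
    rw [mem_filter] at ht
    obtain ⟨-, hpt⟩ := ht
    apply hk
    rw [← hfib t hts, ← hpt]
    rfl

/-- **The realised `θ_Y/n` is within `ε` of `θ̄_Y`** for an `ε`-admissible `Y`-sequence. [cite: AlmanDuanVassilevskaWilliamsXuXuZhou2025, Thm. 5.3 (proof, continuity step)] -/
theorem abs_pairDistY_sub_targetPairDistY_le (T : (Fin n → Fin (2 * c + 1)) × (Fin n → Fin (2 * c + 1)) × (Fin n → Fin (2 * c + 1)))
    (h : IsLevelTriple c (seqVal T.1) (seqVal T.2.1) (seqVal T.2.2)) {γX γY γZ : ℕ × ℕ × ℕ → (Fin c → Fin 3) → ℝ}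
    {ε : ℝ} (hε : 0 ≤ ε) {Jh : Fin n → Fin c → Fin 3}
    (hJ : Jh ∈ levelBlocksY (tripleTermMap h) (tripleTermList c γX γY γZ) ε) (p : Fin (2 * c + 1) × (Fin c → Fin 3)) :
    |((letterCount (GlobalStageData.pairSeq T.2.1 Jh) p : ℕ) : ℝ) / n - targetPairDistY h γY p| ≤ ε := by
  rw [letterCount_pairSeqY_div_eq_sum T h Jh p]
  simp only [targetPairDistY]
  rw [← sum_sub_distrib]
  refine (abs_sum_le_sum_abs _ _).trans ?_
  calc _ ≤ ∑ s, ((termFibre (tripleTermMap h) s).card : ℝ) / n * ε := by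
        refine sum_le_sum fun s _ => ?_
        have hw : (0 : ℝ) ≤ ((termFibre (tripleTermMap h) s).card : ℝ) / n := by positivity
        split_ifs with hk
        · rw [← mul_sub, abs_mul, abs_of_nonneg hw]
          rcases (termFibre (tripleTermMap h) s).eq_empty_or_nonempty with h0 | hne
          · rw [h0, card_empty, Nat.cast_zero, zero_div, zero_mul, zero_mul]
          · refine mul_le_mul_of_nonneg_left ?_ hw
            have := (mem_admissibleSeqs.1 hJ).2 s hne p.2
            simpa [tripleTermList] using this
        · rw [sub_zero, abs_zero]; exact mul_nonneg hw hε
    _ = (∑ s, ((termFibre (tripleTermMap h) s).card : ℝ) / n) * ε := by rw [sum_mul]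
    _ ≤ 1 * ε := mul_le_mul_of_nonneg_right (sum_card_termFibre_div_le _) hε
    _ = ε := one_mul ε

/-- **`H(θ_Y/n) ≥ H(β̄_Y) − |A_pair| m(ε)`** for the realised `Y`-block (continuity of `H`).
[cite: AlmanDuanVassilevskaWilliamsXuXuZhou2025, Thm. 5.3 (proof, continuity step)] -/
theorem shannonEntropy_targetPairDistY_sub_le (T : (Fin n → Fin (2 * c + 1)) × (Fin n → Fin (2 * c + 1)) × (Fin n → Fin (2 * c + 1)))
    (h : IsLevelTriple c (seqVal T.1) (seqVal T.2.1) (seqVal T.2.2)) {γX γY γZ : ℕ × ℕ × ℕ → (Fin c → Fin 3) → ℝ}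
    (hγ0 : ∀ ijk σ, 0 ≤ γY ijk σ) (hγ1 : ∀ ijk σ, γY ijk σ ≤ 1) {ε : ℝ} (hε0 : 0 ≤ ε) (hε1 : ε ≤ 1)
    {Jh : Fin n → Fin c → Fin 3} (hJ : Jh ∈ levelBlocksY (tripleTermMap h) (tripleTermList c γX γY γZ) ε) :
    shannonEntropy (targetPairDistY h γY) - Fintype.card (Fin (2 * c + 1) × (Fin c → Fin 3)) * entropyModulus ε ≤
      shannonEntropy (fun p => ((letterCount (GlobalStageData.pairSeq T.2.1 Jh) p : ℕ) : ℝ) / n) := by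
  refine le_shannonEntropy_add_of_abs_sub_le (fun p => by positivity) (fun p => ?_)
    (fun p => (targetPairDistY_mem_Icc h hγ0 hγ1 p).1) (fun p => (targetPairDistY_mem_Icc h hγ0 hγ1 p).2) hε1
    (fun p => abs_pairDistY_sub_targetPairDistY_le T h hε0 hJ p)
  rcases Nat.eq_zero_or_pos n with h0 | hpos
  · subst h0; simp
  · rw [div_le_one (by exact_mod_cast hpos)]
    have := sum_letterCount (GlobalStageData.pairSeq T.2.1 Jh)
    have hle : letterCount (GlobalStageData.pairSeq T.2.1 Jh) p ≤ n :=
      (single_le_sum (f := letterCount (GlobalStageData.pairSeq T.2.1 Jh)) (fun _ _ => Nat.zero_le _)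
        (mem_univ p)).trans_eq this
    exact_mod_cast hle

/-- **`Λ_Y/n ≤ η_Y + 3^c m(ε)`** for the class types of the realised `Y`-block (`ε`-admissible for the coarse
`Y`-datum, then continuity of `H` class by class, weights `|S|/n`). [cite: AlmanDuanVassilevskaWilliamsXuXuZhou2025, Thm. 5.3 (proof, continuity step)] -/
theorem realisedEta_le_targetEta_add {α : ℕ × ℕ × ℕ → ℝ} {γX γY γZ : ℕ × ℕ × ℕ → (Fin c → Fin 3) → ℝ}
    {I J K : Fin n → ℕ} (h : IsLevelTriple c I J K) (hα : IsAlphaConsistent α I J K) (hα0 : ∀ ijk, 0 ≤ α ijk)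
    (hγ0 : ∀ ijk σ, 0 ≤ γY ijk σ) (hγ1 : ∀ ijk σ, γY ijk σ ≤ 1) {ε : ℝ} (hε0 : 0 ≤ ε) (hε1 : ε ≤ 1)
    {Jh : Fin n → Fin c → Fin 3} (hJ : Jh ∈ levelBlocksY (tripleTermMap h) (tripleTermList c γX γY γZ) ε) :
    (∑ s, ((termFibre (coarseYTermMap h) s).card : ℝ) *
        shannonEntropy (fun σ => (coarseYProfile h Jh s σ : ℝ) / (termFibre (coarseYTermMap h) s).card)) / n ≤
      targetEta h α γY + Fintype.card (Fin c → Fin 3) * entropyModulus ε := by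
  have hadm := mem_levelBlocksX_coarseY_of_mem_levelBlocksY h hα hJ
  have hreal : (∑ s, ((termFibre (coarseYTermMap h) s).card : ℝ) *
      shannonEntropy (fun σ => (coarseYProfile h Jh s σ : ℝ) / (termFibre (coarseYTermMap h) s).card)) / n =
      ∑ s, ((termFibre (coarseYTermMap h) s).card : ℝ) / n * shannonEntropy (completeSplitOn Jh (termFibre (coarseYTermMap h) s)) := by
    rw [sum_div]
    refine sum_congr rfl fun s _ => ?_
    rw [mul_div_right_comm]
    rfl
  rw [hreal, targetEta]
  set NE := (univ : Finset (Fin (coarseYClasses c).card)).filter fun s => (termFibre (coarseYTermMap h) s).Nonempty with hNE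
  have hrestrict : ∀ (f : Fin (coarseYClasses c).card → ℝ),
      ∑ s, ((termFibre (coarseYTermMap h) s).card : ℝ) / n * f s = ∑ s ∈ NE, ((termFibre (coarseYTermMap h) s).card : ℝ) / n * f s := by
    intro f
    rw [hNE, sum_filter_of_ne]
    intro s _ hne
    by_contra hempty
    rw [not_nonempty_iff_eq_empty] at hempty
    rw [hempty, card_empty, Nat.cast_zero, zero_div, zero_mul] at hne
    exact hne rfl
  rw [hrestrict (fun s => shannonEntropy (completeSplitOn Jh (termFibre (coarseYTermMap h) s))),
    hrestrict (fun s => shannonEntropy (coarseYTermList c α γY s).γX)]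
  have hw : ∀ s ∈ NE, (0 : ℝ) ≤ ((termFibre (coarseYTermMap h) s).card : ℝ) / n := fun s _ => by positivity
  have hw1 : ∑ s ∈ NE, ((termFibre (coarseYTermMap h) s).card : ℝ) / n ≤ 1 :=
    (sum_le_sum_of_subset_of_nonneg (filter_subset _ _) fun s _ _ => by positivity).trans (sum_card_termFibre_div_le _)
  have hQ : ∀ s σ, 0 ≤ (coarseYTermList c α γY s).γX σ ∧ (coarseYTermList c α γY s).γX σ ≤ 1 := fun s σ =>
    coarseYGamma_mem_Icc hα0 hγ0 hγ1 _ σ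
  have hclose : ∀ s ∈ NE, ∀ σ, |completeSplitOn Jh (termFibre (coarseYTermMap h) s) σ - (coarseYTermList c α γY s).γX σ| ≤ ε := by
    intro s hs σ
    have hne : (termFibre (coarseYTermMap h) s).Nonempty := (mem_filter.1 hs).2
    exact (mem_admissibleSeqs.1 hadm).2 s hne σ
  have habs := abs_sum_mul_shannonEntropy_sub_le NE hw hw1
    (P := fun s => completeSplitOn Jh (termFibre (coarseYTermMap h) s)) (Q := fun s => (coarseYTermList c α γY s).γX)
    (fun s _ σ => completeSplitOn_nonneg _ _ σ) (fun s _ σ => completeSplitOn_le_one _ _ σ)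
    (fun s _ σ => (hQ s σ).1) (fun s _ σ => (hQ s σ).2) hε0 hε1 hclose
  rw [abs_le] at habs
  linarith [habs.2]

end TargetY

/-! ## Theorem 5.3 (more asymmetric), one region -/

section Thm53

variable (R : Type u) [CommSemiring R] (q : ℕ) {c n : ℕ}
variable {Q : Fin (2 * c + 1) × Fin (2 * c + 1) × Fin (2 * c + 1) → ℕ}
variable {T₀ : (Fin n → Fin (2 * c + 1)) × (Fin n → Fin (2 * c + 1)) × (Fin n → Fin (2 * c + 1))}

/-- Arithmetic of the exponent: replacing the second and third branches of the minimum by smaller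
quantities up to `e₂, e₃ ≥ 0` costs at most `e₂ + e₃`. [folklore] -/
theorem min_branch_sub_le₂ {A Bt Br Ct Cr D e₂ e₃ m Err L : ℝ} (hm : 0 ≤ m) (h2 : Bt - e₂ ≤ Br) (h3 : Ct - e₃ ≤ Cr)
    (he2 : 0 ≤ e₂) (he3 : 0 ≤ e₃) (hL : m * min (min A Br) (min Cr D) - Err ≤ L) :
    m * (min (min A Bt) (min Ct D) - (e₂ + e₃)) - Err ≤ L := by
  refine le_trans ?_ hL
  have hmin : min (min A Bt) (min Ct D) - (e₂ + e₃) ≤ min (min A Br) (min Cr D) := by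
    refine le_min (le_min ?_ ?_) (le_min ?_ ?_)
    · linarith [min_le_left (min A Bt) (min Ct D), min_le_left A Bt]
    · linarith [min_le_left (min A Bt) (min Ct D), min_le_right A Bt]
    · linarith [min_le_right (min A Bt) (min Ct D), min_le_left Ct D]
    · linarith [min_le_right (min A Bt) (min Ct D), min_le_right Ct D]
  linarith [mul_le_mul_of_nonneg_left hmin hm]

/-- **Alman–Duan–Vassilevska Williams–Xu–Xu–Zhou, Theorem 5.3 — one region (identity permutation), at fixed
`n`, with explicit errors.**  For a joint type `Q` of level-`ℓ` block triples (`∑ Q = n`, supported on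
`i+j+k = 2c`), a triple `T₀` of type `Q` (whose term map `τ₀` realises the parameter list
`{(n α(i,j,k), i, j, k, β_{X,i,j,k}, β_{Y,i,j,k}, β_{Z,i,j,k})}`, `α = Q/n`), target split distributions `β`
with `0 ≤ β_Y, β_Z ≤ 1` and `0 ≤ ε ≤ 1`: `((n+1)^{3^c |S₃|})^3 = 2^{o(n)}` independent copies of
`(CW_q^{⊗c})^{⊗n}` restrict to (hence degenerate to) `κ` independent copies of the level-`ℓ` `ε`-interface
tensor `𝒯_{τ₀, L(β), ε}`, where `log₂(κ+1) ≥ n · (E₁ − epsLoss₂ c ε) − thm53Err c n`,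
`E₁ = min{H(Q_X/n) − P, H(θ̄_Y) − η_Y, H(θ̄_Z) − λ_Z, H(Q/n)}` (`P = maxEnt(Q/n) − H(Q/n)` the penalty `P_α`
at the type, `H(θ̄_Y) = H(β̄_Y)`, `η_Y = targetEta`, `H(θ̄_Z) = H(β̄_Z)`, `λ_Z = targetLambda`, the last branch
dominated by the first), `epsLoss₂ → 0` as `ε → 0` and `thm53Err = o(n)` — the printed
`2^{(A₁E₁ − o_{1/ε}(1)) n − o(n)}` for the first region (`A₁ n ↦ n`), `E₁ = min{H(α_X) − P_α, H(β̄_Y) − η_Y, H(β̄_Z) − λ_Z}`.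
[cite: AlmanDuanVassilevskaWilliamsXuXuZhou2025, Thm. 5.3 and Prop. 5.1] -/
theorem advxxz2025_thm53_region (hc : 0 < c) (hn : 0 < n) (hQ : ∑ s, Q s = n)
    (hQs : ∀ s, s ∉ levelSupport (2 * c) → Q s = 0) (hT₀ : T₀ ∈ jointTypeClass n Q)
    (γX γY γZ : ℕ × ℕ × ℕ → (Fin c → Fin 3) → ℝ) (hγY0 : ∀ ijk σ, 0 ≤ γY ijk σ) (hγY1 : ∀ ijk σ, γY ijk σ ≤ 1)
    (hγZ0 : ∀ ijk σ, 0 ≤ γZ ijk σ) (hγZ1 : ∀ ijk σ, γZ ijk σ ≤ 1) {ε : ℝ} (hε0 : 0 ≤ ε) (hε1 : ε ≤ 1) :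
    ∃ κ : ℕ,
      TensorRestrictsTo
        (kroneckerTensor (unitTensor R (((n + 1) ^ (3 ^ c * (constituentTriples c).card)) ^ 3))
          (kroneckerPow (kroneckerPow (bigCwTensor R q) c) n))
        (kroneckerTensor (unitTensor R κ)
          (interfaceTensor R q (tripleTermMap (isLevelTriple_of_mem_jointTypeClass hQs hT₀)) (tripleTermList c γX γY γZ) ε)) ∧
      (n : ℝ) * (min (min (shannonEntropy (fun i => ((∑ j, ∑ l, Q (i, j, l) : ℕ) : ℝ) / n) -
              (maxEntropyGivenMarginals (levelSupport (2 * c)) (fun s => (Q s : ℝ) / n) - shannonEntropy (fun s => (Q s : ℝ) / n)))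
            (shannonEntropy (targetPairDistY (isLevelTriple_of_mem_jointTypeClass hQs hT₀) γY) -
              targetEta (isLevelTriple_of_mem_jointTypeClass hQs hT₀) (typeAlpha n Q) γY))
          (min (shannonEntropy (targetPairDist (isLevelTriple_of_mem_jointTypeClass hQs hT₀) γZ) -
              targetLambda (isLevelTriple_of_mem_jointTypeClass hQs hT₀) (typeAlpha n Q) γZ)
            (shannonEntropy (fun s => (Q s : ℝ) / n))) - epsLoss₂ c ε) - thm53Err c n ≤
        Real.logb 2 ((κ : ℝ) + 1) := by
  classical
  set τ₀ := tripleTermMap (isLevelTriple_of_mem_jointTypeClass hQs hT₀) with hτ₀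
  set L := tripleTermList c γX γY γZ with hL
  set bound : ℝ := (n : ℝ) * (min (min (shannonEntropy (fun i => ((∑ j, ∑ l, Q (i, j, l) : ℕ) : ℝ) / n) -
              (maxEntropyGivenMarginals (levelSupport (2 * c)) (fun s => (Q s : ℝ) / n) - shannonEntropy (fun s => (Q s : ℝ) / n)))
            (shannonEntropy (targetPairDistY (isLevelTriple_of_mem_jointTypeClass hQs hT₀) γY) -
              targetEta (isLevelTriple_of_mem_jointTypeClass hQs hT₀) (typeAlpha n Q) γY))
          (min (shannonEntropy (targetPairDist (isLevelTriple_of_mem_jointTypeClass hQs hT₀) γZ) -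
              targetLambda (isLevelTriple_of_mem_jointTypeClass hQs hT₀) (typeAlpha n Q) γZ)
            (shannonEntropy (fun s => (Q s : ℝ) / n))) - epsLoss₂ c ε) - thm53Err c n with hbound
  have h2pos : 0 < (2 : ℝ) ^ bound := Real.rpow_pos_of_pos two_pos _
  have hceil : 1 ≤ ⌈(2 : ℝ) ^ bound⌉₊ := Nat.one_le_iff_ne_zero.2 fun h0 => (not_le.2 h2pos) (Nat.ceil_eq_zero.1 h0)
  refine ⟨⌈(2 : ℝ) ^ bound⌉₊ - 1, ?_, ?_⟩
  swap
  · have hκ1 : (((⌈(2 : ℝ) ^ bound⌉₊ - 1 : ℕ) : ℝ) + 1) = ⌈(2 : ℝ) ^ bound⌉₊ := by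
      rw [Nat.cast_sub hceil]; push_cast; ring
    rw [hκ1]
    calc bound = Real.logb 2 ((2 : ℝ) ^ bound) := (Real.logb_rpow two_pos (by norm_num)).symm
      _ ≤ Real.logb 2 (⌈(2 : ℝ) ^ bound⌉₊ : ℝ) := Real.logb_le_logb_of_le one_lt_two h2pos (Nat.le_ceil _)
  · have hα0 : ∀ ijk, 0 ≤ typeAlpha n Q ijk := by
      intro ijk; unfold typeAlpha; split_ifs <;> positivity
    have hcell : ∀ j : ↥(realisedCells R q τ₀ L ε),
        TensorRestrictsTo (kroneckerPow (kroneckerPow (bigCwTensor R q) c) n)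
          (kroneckerTensor (unitTensor R (⌈(2 : ℝ) ^ bound⌉₊ - 1)) (interfaceTensor R q τ₀ (cellTermList τ₀ L j.1) 0)) := by
      rintro ⟨abc, habc⟩
      have hmem := habc
      unfold realisedCells at hmem
      rw [mem_filter] at hmem
      obtain ⟨-, x, y, z, hne, rfl⟩ := hmem
      obtain ⟨κj, hres, hbj⟩ := advxxz2025_thm53_cell R q hc hn hQ hQs hT₀ hne
      have hym := (interfaceTensor_ne_zero R q hne).2.1
      have hzm := (interfaceTensor_ne_zero R q hne).2.2
      have hθY := shannonEntropy_targetPairDistY_sub_le T₀ (isLevelTriple_of_mem_jointTypeClass hQs hT₀) hγY0 hγY1 hε0 hε1 hym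
      have hΛY := realisedEta_le_targetEta_add (isLevelTriple_of_mem_jointTypeClass hQs hT₀)
        (isAlphaConsistent_typeAlpha hT₀) hα0 hγY0 hγY1 hε0 hε1 hym
      have hθZ := shannonEntropy_targetPairDist_sub_le T₀ (isLevelTriple_of_mem_jointTypeClass hQs hT₀) hγZ0 hγZ1 hε0 hε1 hzm
      have hΛZ := realisedLambda_le_targetLambda_add (isLevelTriple_of_mem_jointTypeClass hQs hT₀)
        (isAlphaConsistent_typeAlpha hT₀) hα0 hγZ0 hγZ1 hε0 hε1 hzm
      have hbound_le : bound ≤ Real.logb 2 ((κj : ℝ) + 1) := by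
        rw [hbound]
        have he : epsLoss₂ c ε = epsLoss c ε + epsLoss c ε := by unfold epsLoss₂; ring
        rw [he]
        refine min_branch_sub_le₂ (Nat.cast_nonneg n) ?_ ?_ (epsLoss_nonneg c hε0 hε1) (epsLoss_nonneg c hε0 hε1) hbj
        · unfold epsLoss; linarith
        · unfold epsLoss; linarith
      have hκle : ⌈(2 : ℝ) ^ bound⌉₊ - 1 ≤ κj := by
        have h1 : (2 : ℝ) ^ bound ≤ (κj : ℝ) + 1 := (Real.le_logb_iff_rpow_le one_lt_two (by positivity)).1 hbound_le
        have h2 : ⌈(2 : ℝ) ^ bound⌉₊ ≤ κj + 1 := Nat.ceil_le.2 (by exact_mod_cast h1)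
        omega
      exact hres.trans (TensorRestrictsTo.kronecker (tensorRestrictsTo_unitTensor_castLE hκle) (TensorRestrictsTo.refl _))
    have hJ : Fintype.card ↥(realisedCells R q τ₀ L ε) ≤ ((n + 1) ^ (3 ^ c * (constituentTriples c).card)) ^ 3 := by
      rw [Fintype.card_coe]; exact card_realisedCells_le R q τ₀ L ε
    refine (kronecker_unit_le_familyDirectSum_const hJ _).trans ?_
    refine (familyDirectSum_mono hcell).trans ?_
    refine (familyDirectSum_kronecker_unit_le (⌈(2 : ℝ) ^ bound⌉₊ - 1) _).trans ?_
    exact TensorRestrictsTo.kronecker (TensorRestrictsTo.refl _) (vxxz2024_thm53_merge R q τ₀ L ε)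

end Thm53

end Literature.Computability.AlgebraicComplexity
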